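import Mathlib.LinearAlgebra.LinearIndependent.Lemmas
import Mathlib.LinearAlgebra.Dimension.Constructions
import Mathlib.RingTheory.Noetherian.Basic
import Literature.Barriers.MatrixMultiplication.NilpotentGroupBarrierGradedCoords
import HarnessLib

/-!
# Slice rank of `D_G` from ANY multiplicative filtration of `K[G]` (bases adapted to a chain of subspaces)

Solo-informed seat, summit `MatrixMultiplication` (gen 61).  The tree's
`Literature.Barriers.MatrixMultiplication.GradedCoords` (BCCGU 2017, Prop. 3.2 in coordinates)
bounds `slice-rank D_G` from a basis of `K[G]` whose structure constants are graded.  This file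
supplies the missing linear algebra — a basis ADAPTED to a finite descending chain of subspaces —
and derives the basis-free form used for non-`p`-groups (e.g. the radical filtration
`K[G] ⊇ J ⊇ J² ⊇ ⋯ ⊇ J^{L+1} = 0` of a non-semisimple group algebra in the defining characteristic
of a group of Lie type):

* `exists_linearIndepOn_adapted`: for a chain `⊤ = I₀ ⊇ I₁ ⊇ ⋯ ⊇ I_N = ⊥` of subspaces of a vector
  space there is a linearly independent spanning set `s` with `I_c = span (s ∩ I_c)` for every `c`.
* `exists_gradedCoords_of_filtration`: if moreover `I_a · I_b ⊆ I_{a+b}` in `K[G]`, graded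
  coordinates (`GradedCoords`, indexed by `Fin |G|`) with `#{k : c ≤ deg k} = dim I_c` exist — the
  composable form (products of groups via `GradedCoords.prod`).
* `sliceRank_mulGroupTensor_le_of_filtration` — **the codimension bound for an arbitrary
  multiplicative filtration**: `slice-rank D_G ≤ codim I_a + codim I_b + dim I_{a+b}` for all `a, b`
  (and the subtraction-free form `sliceRank_mulGroupTensor_add_finrank_le_of_filtration`).

With `I_c = J^c` (`J` the Jacobson radical of `𝔽_q[SL₂(q)]`, `q = pⁿ`, Loewy length `2n+1`) and the
layer dimensions of Alperin / Andersen–Jørgensen–Landrock this is the input of the seat's note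
`paper/sl2-defining-char-note.md` (products of `SL₂(p^{nᵢ})`: no `ω = 2` via TPP/STPP for fixed `p`).
[cite: BlasiakChurchCohnGrochowUmans2017, Prop. 3.2; folklore (adapted bases)]
-/

set_option linter.dupNamespace false

noncomputable section

open scoped BigOperators

namespace Summit.MatrixMultiplication.MatrixMultiplication.Theorems

open Literature.Barriers.MatrixMultiplication Literature.Combinatorics.Additive Submodule

/-! ## Bases adapted to a finite descending chain of subspaces -/

section Adapted

variable {K : Type*} {V : Type*} [DivisionRing K] [AddCommGroup V] [Module K V]

/-- Induction step: a linearly independent subset of `I_{N-m}` adapted to `I_{N-m} ⊇ ⋯ ⊇ I_N = ⊥`.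
[folklore] -/
theorem exists_linearIndepOn_adapted_aux (I : ℕ → Submodule K V) (hanti : Antitone I) (N : ℕ)
    (hN : I N = ⊥) (m : ℕ) :
    ∃ s : Set V, s ⊆ (I (N - m) : Set V) ∧ LinearIndepOn K id s ∧
      ∀ c, N - m ≤ c → (I c : Set V) ⊆ span K (s ∩ (I c : Set V)) := by
  induction m with
  | zero =>
    refine ⟨∅, Set.empty_subset _, linearIndepOn_empty K id, fun c hc => ?_⟩
    have hc' : I c = ⊥ := le_bot_iff.1 (hN ▸ hanti (by simpa using hc))
    simp [hc']
  | succ m ih =>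
    obtain ⟨s, hsI, hli, hsp⟩ := ih
    have hle : I (N - m) ≤ I (N - (m + 1)) := hanti (by omega)
    have hst : s ⊆ (I (N - (m + 1)) : Set V) := fun x hx => hle (hsI hx)
    obtain ⟨b, hbt, hsb, htb, hbli⟩ := exists_linearIndepOn_id_extension hli hst
    refine ⟨b, hbt, hbli, fun c hc => ?_⟩
    by_cases hc' : N - m ≤ c
    · exact (hsp c hc').trans (span_mono (Set.inter_subset_inter_left _ hsb))
    · have hceq : c = N - (m + 1) := by omega
      subst hceq
      rw [Set.inter_eq_left.2 hbt]
      exact htb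

/-- **Adapted bases.** For a descending chain `⊤ = I₀ ⊇ I₁ ⊇ ⋯` of subspaces with `I_N = ⊥` there
is a linearly independent spanning set `s` such that `s ∩ I_c` spans `I_c` for every `c`.
[folklore] -/
theorem exists_linearIndepOn_adapted (I : ℕ → Submodule K V) (h0 : I 0 = ⊤) (hanti : Antitone I)
    (N : ℕ) (hN : I N = ⊥) :
    ∃ s : Set V, LinearIndepOn K id s ∧ ⊤ ≤ span K s ∧
      ∀ c, I c = span K (s ∩ (I c : Set V)) := by
  obtain ⟨s, -, hli, hsp⟩ := exists_linearIndepOn_adapted_aux I hanti N hN N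
  refine ⟨s, hli, ?_, fun c =>
    le_antisymm (hsp c (by simp)) (span_le.2 Set.inter_subset_right)⟩
  intro x _
  have hx : x ∈ (I 0 : Set V) := by simp [h0]
  have := hsp 0 (by simp) hx
  simpa [h0] using this

/-- Levels in the chain: for a nonzero vector, membership in `I_c` is `c ≤` the largest `c' ≤ N`
with `v ∈ I_{c'}`. [folklore] -/
theorem mem_iff_le_findGreatest (I : ℕ → Submodule K V) (h0 : I 0 = ⊤) (hanti : Antitone I)
    (N : ℕ) (hN : I N = ⊥) {v : V} [DecidablePred fun c => v ∈ I c] (hv : v ≠ 0) (c : ℕ) :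
    v ∈ I c ↔ c ≤ Nat.findGreatest (fun c => v ∈ I c) N := by
  have hspec : v ∈ I (Nat.findGreatest (fun c => v ∈ I c) N) :=
    Nat.findGreatest_spec (P := fun c => v ∈ I c) (Nat.zero_le N) (by simp [h0])
  constructor
  · intro hvc
    by_cases hcN : c ≤ N
    · exact Nat.le_findGreatest (P := fun c => v ∈ I c) hcN hvc
    · exfalso
      have : v ∈ I N := hanti (by omega) hvc
      rw [hN, mem_bot] at this
      exact hv this
  · intro hc
    exact hanti hc hspec

end Adapted

/-! ## The codimension bound for an arbitrary multiplicative filtration of `K[G]` -/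

section Filtration

universe u v

variable {K : Type v} [Field K] {G : Type u} [Group G] [Fintype G] [DecidableEq G]

/-- **Graded coordinates from a multiplicative filtration, with exact layer counts**: for subspaces
`K[G] = I₀ ⊇ I₁ ⊇ ⋯ ⊇ I_N = 0` with `I_a · I_b ⊆ I_{a+b}` there are graded coordinates on `K[G]`
(indexed by `Fin |G|`) with `#{k : c ≤ deg k} = dim I_c` for every `c` — the composable form
(products via `GradedCoords.prod`). [cite: BlasiakChurchCohnGrochowUmans2017, Prop. 3.2 and §2.3] -/
theorem exists_gradedCoords_of_filtration (I : ℕ → Submodule K (MonoidAlgebra K G))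
    (h0 : I 0 = ⊤) (hanti : Antitone I)
    (hmul : ∀ a b : ℕ, ∀ f g : MonoidAlgebra K G, f ∈ I a → g ∈ I b → f * g ∈ I (a + b))
    (N : ℕ) (hN : I N = ⊥) :
    ∃ B : GradedCoords K G (Fin (Fintype.card G)),
      ∀ c, Fintype.card {k : Fin (Fintype.card G) // c ≤ B.deg k} = Module.finrank K (I c) := by
  classical
  obtain ⟨s, hli, hsp, hI⟩ := exists_linearIndepOn_adapted I h0 hanti N hN
  haveI : Module.Finite K (MonoidAlgebra K G) := Module.Finite.of_basis (MonoidAlgebra.basis G K)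
  have hli' : LinearIndependent K ((↑) : s → MonoidAlgebra K G) := hli
  have hfin : s.Finite := hli'.set_finite_of_isNoetherian
  letI : Fintype s := hfin.fintype
  -- the adapted basis and its degree
  let β : Module.Basis s K (MonoidAlgebra K G) :=
    Module.Basis.mk hli' (by rw [Subtype.range_coe]; exact hsp)
  have hβ : ∀ k : s, β k = (k : MonoidAlgebra K G) := fun k => by
    simp [β, Module.Basis.mk_apply]
  let deg : s → ℕ := fun k => Nat.findGreatest (fun c => (k : MonoidAlgebra K G) ∈ I c) N
  have hne : ∀ k : s, (k : MonoidAlgebra K G) ≠ 0 := fun k => by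
    have := hli'.ne_zero k
    simpa using this
  have hdeg : ∀ (k : s) (c : ℕ), (k : MonoidAlgebra K G) ∈ I c ↔ c ≤ deg k := fun k c =>
    mem_iff_le_findGreatest I h0 hanti N hN (hne k) c
  -- `s ∩ I_c` is the set of basis vectors of degree `≥ c`
  have hset : ∀ c, s ∩ (I c : Set (MonoidAlgebra K G)) = β '' {k | c ≤ deg k} := by
    intro c
    ext v
    constructor
    · rintro ⟨hv, hvI⟩
      exact ⟨⟨v, hv⟩, (hdeg ⟨v, hv⟩ c).1 hvI, hβ ⟨v, hv⟩⟩
    · rintro ⟨k, hk, rfl⟩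
      rw [hβ]
      exact ⟨k.2, (hdeg k c).2 hk⟩
  -- the structure constants are graded
  have hmulβ : ∀ i j : s, β i * β j ∈ span K (β '' {k | deg i + deg j ≤ deg k}) := by
    intro i j
    rw [← hset, ← hI, hβ, hβ]
    exact hmul _ _ _ _ ((hdeg i _).2 le_rfl) ((hdeg j _).2 le_rfl)
  -- counting: `#{k : c ≤ deg k} = dim I_c`, `#s = |G|`
  have hcount : ∀ c, Fintype.card {k : s // c ≤ deg k} = Module.finrank K (I c) := by
    intro c
    have hrange : (β '' {k | c ≤ deg k}) =
        Set.range (fun k : {k : s // c ≤ deg k} => β k.1) := by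
      ext v
      simp
    have hlin : LinearIndependent K (fun k : {k : s // c ≤ deg k} => β k.1) :=
      β.linearIndependent.comp _ Subtype.val_injective
    rw [hI c, hset c, hrange, finrank_span_eq_card hlin]
  have hcard_s : Fintype.card s = Fintype.card G := by
    rw [← Module.finrank_eq_card_basis β, Module.finrank_eq_card_basis (MonoidAlgebra.basis G K)]
  -- reindex by `Fin |G|`
  let e : s ≃ Fin (Fintype.card G) := (Fintype.equivFin s).trans (finCongr hcard_s)
  let β' : Module.Basis (Fin (Fintype.card G)) K (MonoidAlgebra K G) := β.reindex e
  let deg' : Fin (Fintype.card G) → ℕ := fun k => deg (e.symm k)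
  have hβ' : ∀ k, β' k = β (e.symm k) := fun k => Module.Basis.reindex_apply _ _ _
  have himg : ∀ S : Set ℕ, β' '' {k | deg' k ∈ S} = β '' {k | deg k ∈ S} := by
    intro S
    ext v
    simp only [Set.mem_image, Set.mem_setOf_eq, hβ', deg']
    constructor
    · rintro ⟨k, hk, rfl⟩
      exact ⟨e.symm k, hk, rfl⟩
    · rintro ⟨k, hk, rfl⟩
      exact ⟨e k, by simpa using hk, by simp⟩
  have hmulβ' : ∀ i j, β' i * β' j ∈ span K (β' '' {k | deg' i + deg' j ≤ deg' k}) := by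
    intro i j
    have := himg {d | deg' i + deg' j ≤ d}
    simp only [Set.mem_setOf_eq] at this
    rw [this, hβ', hβ']
    exact hmulβ _ _
  refine ⟨GradedCoords.ofBasis β' deg' hmulβ', fun c => ?_⟩
  rw [← hcount c]
  exact Fintype.card_congr (e.symm.subtypeEquiv (fun k => by simp [deg']))

/-- **Slice rank of `D_G` from a multiplicative filtration** (BCCGU 2017, Prop. 3.2, basis-free):
for subspaces `K[G] = I₀ ⊇ I₁ ⊇ ⋯ ⊇ I_N = 0` with `I_a · I_b ⊆ I_{a+b}`,
`slice-rank D_G ≤ codim I_a + codim I_b + dim I_{a+b}` for all `a, b`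
(e.g. `I_c = J^c` for the Jacobson radical `J`, or any power filtration of a two-sided ideal).
[cite: BlasiakChurchCohnGrochowUmans2017, Prop. 3.2] -/
theorem sliceRank_mulGroupTensor_le_of_filtration (I : ℕ → Submodule K (MonoidAlgebra K G))
    (h0 : I 0 = ⊤) (hanti : Antitone I)
    (hmul : ∀ a b : ℕ, ∀ f g : MonoidAlgebra K G, f ∈ I a → g ∈ I b → f * g ∈ I (a + b))
    (N : ℕ) (hN : I N = ⊥) (a b : ℕ) :
    sliceRank (mulGroupTensor K G) ≤
      (Fintype.card G - Module.finrank K (I a)) + (Fintype.card G - Module.finrank K (I b)) +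
        Module.finrank K (I (a + b)) := by
  classical
  obtain ⟨B, hcount⟩ := exists_gradedCoords_of_filtration I h0 hanti hmul N hN
  have hlt : ∀ c, Fintype.card {k : Fin (Fintype.card G) // B.deg k < c} =
      Fintype.card G - Module.finrank K (I c) := by
    intro c
    rw [← hcount c,
      Fintype.card_congr (Equiv.subtypeEquivRight (fun k => (not_le (a := c) (b := B.deg k)).symm)),
      Fintype.card_subtype_compl, Fintype.card_fin]
  have hB := B.sliceRank_le a b
  convert hB using 3
  all_goals
    first
    | rw [hlt a]
    | rw [hlt b]
    | rw [hcount (a + b)]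

/-- The same bound with the three parameters decoupled (`I_a · I_b ⊆ I_c` whenever `a + b ≥ c`,
by antitonicity), in the form quoted in the seat's note (Theorem B):
`slice-rank D_G ≤ codim I_a + codim I_b + dim I_{a+b}`, minimised over `a, b` by the user.
[cite: BlasiakChurchCohnGrochowUmans2017, Prop. 3.2] -/
theorem sliceRank_mulGroupTensor_add_finrank_le_of_filtration
    (I : ℕ → Submodule K (MonoidAlgebra K G)) (h0 : I 0 = ⊤) (hanti : Antitone I)
    (hmul : ∀ a b : ℕ, ∀ f g : MonoidAlgebra K G, f ∈ I a → g ∈ I b → f * g ∈ I (a + b))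
    (N : ℕ) (hN : I N = ⊥) (a b : ℕ) :
    sliceRank (mulGroupTensor K G) + Module.finrank K (I a) + Module.finrank K (I b) ≤
      2 * Fintype.card G + Module.finrank K (I (a + b)) := by
  have h := sliceRank_mulGroupTensor_le_of_filtration I h0 hanti hmul N hN a b
  haveI : Module.Finite K (MonoidAlgebra K G) := Module.Finite.of_basis (MonoidAlgebra.basis G K)
  have hG : Module.finrank K (MonoidAlgebra K G) = Fintype.card G :=
    Module.finrank_eq_card_basis (MonoidAlgebra.basis G K)
  have ha : Module.finrank K (I a) ≤ Fintype.card G := hG ▸ Submodule.finrank_le (I a)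
  have hb : Module.finrank K (I b) ≤ Fintype.card G := hG ▸ Submodule.finrank_le (I b)
  omega

end Filtration

end Summit.MatrixMultiplication.MatrixMultiplication.Theorems
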